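import Literature.NumberTheory.Rogawski1990.AdelicStableClassSupportFinite
import Literature.NumberTheory.Rogawski1990.AnisotropicUnitarySemisimple
import Literature.LinearAlgebra.SemisimpleSimilarityCharpoly
import HarnessLib

/-!
# Only finitely many stable classes of the ANISOTROPIC `U(H)(L⁺)` — regular or SINGULAR — carry an adelic matching class through a compact set
(Rogawski (1990), §3.1 p. 19, §3.8 p. 27, §5.4 (5.4.3) pp. 72–73, §14.5 pp. 237–239; Kottwitz (1986) §7; Jacobson IV §7 Thm. 5)

Topic `NumberTheory/Rogawski1990`; namespace `Literature.NumberTheory.Rogawski1990`.  THEOREMS ONLY (no definition, no instance, no named fact, no `sorry`).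
Cell `pub/hodgecm-mathlib`, ENGINE T1 (crux H413 = `stmt-HodgeConjecture-24833`), row O7 «singular semisimple classes» (A-p01 CENSUS-O7, K6): the SINGULAR
twin of ★ (SF-st) `AdelicStableClassSupportFinite` — pin (xii-f) «`Function.support (𝒪 ↦ SJ_G(𝒪, f))` is finite» over ALL stable classes of the inner form,
not only the regular ones.  HC_CM is proved only modulo the printed citations until rung 0 closes.

THE ONE CHANGE.  ★ SF-st uses regularity only in its §1: «`StableClass.charpoly` is injective on the REGULAR stable classes» (separable characteristic polynomial
⇒ non-derogatory ⇒ similar iff equal characteristic polynomials).  For SEMISIMPLE elements the same rigidity holds without separability — two semisimple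
endomorphisms are similar iff their characteristic polynomials agree [Jacobson IV §7 Thm. 5 with Hungerford VII Cor. 4.8 (ii); ★
`Literature.LinearAlgebra.exists_eq_conj_iff_charpoly_eq_of_isSemisimple`] — and every element of the unitary group of an ANISOTROPIC hermitian form is
semisimple (★ `isSemisimpleElt_of_anisotropic`: each invariant subspace has the invariant complement `W^⊥`) [Rogawski1990, §14.5 p. 237: «since `G′` is
anisotropic, every `γ ∈ G′` is semisimple»].  The adelic half (★ SF-st §2: the characteristic polynomial of a matching adèle is the rational one diagonally
embedded; ★ SF-st §3∕§4: compactness ⇒ finitely many coefficient vectors; support) is regularity-free and is REUSED here by name through its statements.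

* §1 **`isConj_units_of_charpoly_eq_of_isSemisimple`** (any field, any finite index type): invertible matrices with semisimple `toLin'` and equal characteristic
  polynomials are conjugate in `GL`; **`isStablyConj_of_charpoly_eq_of_isSemisimpleElt`**, **`stableClassOf_eq_of_charpoly_eq_of_isSemisimpleElt`**,
  **`injective_stableClassCharpoly_of_anisotropic`** (for anisotropic `J`, `𝒪 ↦ p_𝒪` is injective on ALL of `StableClass σ J`);
* §2 **`finite_setOf_stableClass_meets_of_anisotropic`** and **`finite_setOf_stableClass_adelicStableOrbitalIntegralG_ne_zero_of_anisotropic`** — ★ SF-st §3∕§4 with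
  the hypothesis `IsRegularElt γ₀` DROPPED under `hanis`.

## References
* [Rogawski1990] J. D. Rogawski, *Automorphic Representations of Unitary Groups in Three Variables*, Ann. of Math. Stud. 123 (1990), §3.1 p. 19, §3.8 p. 27,
  §5.4 (5.4.3) pp. 72–73, §14.5 pp. 237–239.
* [Kottwitz1986] R. E. Kottwitz, *Stable trace formula: elliptic singular terms*, Math. Ann. 275 (1986), §7.
* [Jacobson] N. Jacobson, *Lectures in Abstract Algebra II: Linear Algebra* (1953), Ch. IV §7 Thm. 5.
-/

set_option autoImplicit false

noncomputable section

open NumberField IsDedekindDomain Filter Function MeasureTheory Polynomial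
open scoped MatrixGroups

namespace Literature.NumberTheory.Rogawski1990

open Literature.NumberTheory.Automorphic Literature.MeasureTheory.Group
open Literature.AlgebraicGeometry.ShimuraVarieties (unitaryGroup)

/-! ## §1 Semisimple classes are determined by their characteristic polynomial -/

section LinearAlgebra

/-- **Two invertible matrices over a field with SEMISIMPLE associated endomorphisms and the same characteristic polynomial are conjugate in `GL`**
(★ `exists_eq_conj_iff_charpoly_eq_of_isSemisimple` for `toLin'`, read back on matrices through `LinearMap.toMatrix'`).
[cite: Jacobson, Ch. IV §7 Thm. 5] [cite: Rogawski1990, §3.1 p. 19] -/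
theorem isConj_units_of_charpoly_eq_of_isSemisimple {K : Type*} [Field K] {n : Type*} [Fintype n] [DecidableEq n] (γ δ : GL n K)
    (hγ : Module.End.IsSemisimple (Matrix.toLin' (γ : Matrix n n K))) (hδ : Module.End.IsSemisimple (Matrix.toLin' (δ : Matrix n n K)))
    (h : (γ : Matrix n n K).charpoly = (δ : Matrix n n K).charpoly) : IsConj γ δ := by
  have hc : (Matrix.toLin' (γ : Matrix n n K)).charpoly = (Matrix.toLin' (δ : Matrix n n K)).charpoly := by
    rw [Matrix.charpoly_toLin', Matrix.charpoly_toLin', h]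
  obtain ⟨e, he⟩ := (Literature.LinearAlgebra.exists_eq_conj_iff_charpoly_eq_of_isSemisimple _ _ hγ hδ).2 hc
  -- the matrices of `e` and `e⁻¹`
  set C : Matrix n n K := LinearMap.toMatrix' (e : (n → K) →ₗ[K] (n → K)) with hC
  set C' : Matrix n n K := LinearMap.toMatrix' (e.symm : (n → K) →ₗ[K] (n → K)) with hC'
  have hCC' : C * C' = 1 := by
    rw [hC, hC', ← LinearMap.toMatrix'_comp, ← LinearEquiv.coe_trans, LinearEquiv.symm_trans_self, LinearEquiv.refl_toLinearMap,
      LinearMap.toMatrix'_id]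
  have hC'C : C' * C = 1 := by
    rw [hC, hC', ← LinearMap.toMatrix'_comp, ← LinearEquiv.coe_trans, LinearEquiv.self_trans_symm, LinearEquiv.refl_toLinearMap,
      LinearMap.toMatrix'_id]
  -- `δ = C γ C⁻¹`
  have hmat : (δ : Matrix n n K) = C * (γ : Matrix n n K) * C' := by
    have h1 := congrArg LinearMap.toMatrix' he
    rw [LinearMap.toMatrix'_toLin', LinearEquiv.conj_apply, LinearMap.toMatrix'_comp, LinearMap.toMatrix'_comp, LinearMap.toMatrix'_toLin'] at h1
    rw [h1, hC, hC']
  refine isConj_iff.2 ⟨⟨C, C', hCC', hC'C⟩, Units.ext ?_⟩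
  rw [Units.val_mul, Units.val_mul, hmat]
  rfl

/-- **Semisimple elements of `U_σ(J)(K)` with the same characteristic polynomial are STABLY conjugate** (stable conjugacy = conjugacy in `GL_m(K)`,
★ `StableConjugacyU3`). [cite: Rogawski1990, §3.1 p. 19] [cite: Jacobson, Ch. IV §7 Thm. 5] -/
theorem isStablyConj_of_charpoly_eq_of_isSemisimpleElt {K : Type*} [Field K] {n : Type*} [Fintype n] [DecidableEq n] {σ : K →+* K}
    {J : Matrix n n K} {γ δ : unitaryGroup σ J} (hγ : IsSemisimpleElt σ J γ) (hδ : IsSemisimpleElt σ J δ)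
    (h : ((γ.val : GL n K) : Matrix n n K).charpoly = ((δ.val : GL n K) : Matrix n n K).charpoly) : IsStablyConj σ J γ δ :=
  isConj_units_of_charpoly_eq_of_isSemisimple _ _ hγ hδ h

/-- Hence `p_δ = p_γ` for semisimple `γ, δ` forces `𝒪_st(δ) = 𝒪_st(γ)`. [cite: Rogawski1990, §3.1 p. 19] -/
theorem stableClassOf_eq_of_charpoly_eq_of_isSemisimpleElt {K : Type*} [Field K] {n : Type*} [Fintype n] [DecidableEq n] {σ : K →+* K}
    {J : Matrix n n K} {γ δ : unitaryGroup σ J} (hγ : IsSemisimpleElt σ J γ) (hδ : IsSemisimpleElt σ J δ)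
    (h : ((δ.val : GL n K) : Matrix n n K).charpoly = ((γ.val : GL n K) : Matrix n n K).charpoly) : stableClassOf σ J δ = stableClassOf σ J γ :=
  stableClassOf_eq_iff.mpr (isStablyConj_of_charpoly_eq_of_isSemisimpleElt hδ hγ h)

/-- **For an ANISOTROPIC hermitian `J` the characteristic polynomial is INJECTIVE on ALL stable classes of `U_σ(J)(L)`** (every element is semisimple,
★ `isSemisimpleElt_of_anisotropic`). [cite: Rogawski1990, §14.5 p. 237; §3.1 p. 19] -/
theorem injective_stableClassCharpoly_of_anisotropic {L' : Type*} [Field L'] {n : Type*} [Fintype n] [DecidableEq n] {σ : L' →+* L'}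
    {J : Matrix n n L'} (hanis : ∀ x : n → L', Literature.AlgebraicGeometry.ShimuraVarieties.hermForm σ J x x = 0 → x = 0) :
    Function.Injective (StableClass.charpoly (σ := σ) (H := J)) := by
  intro 𝒪 𝒪' h
  obtain ⟨γ, rfl⟩ := stableClassOf_surjective 𝒪
  obtain ⟨γ', rfl⟩ := stableClassOf_surjective 𝒪'
  rw [StableClass.charpoly_stableClassOf, StableClass.charpoly_stableClassOf] at h
  exact (stableClassOf_eq_of_charpoly_eq_of_isSemisimpleElt (isSemisimpleElt_of_anisotropic σ J hanis γ) (isSemisimpleElt_of_anisotropic σ J hanis γ')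
    h.symm).symm

end LinearAlgebra

/-! ## §2 Finiteness across ALL stable classes of the anisotropic inner form -/

section Finite

variable {L : Type} [Field L] [NumberField L] [IsCMField L] {H : Matrix (Fin 3) (Fin 3) L}

/-- **Only finitely many stable classes of the ANISOTROPIC `U(H)(L⁺)` — regular or singular — have an adelic matching class through a compact
`C ⊆ U(Φ₃)(𝔸_L)`**: ★ SF-st §3 verbatim with the characteristic-polynomial rigidity of §1 in place of the regular one (every coefficient of `p_𝒪` lies in a
finite set, ★ SF-st §2 `MatchingAdeleG.algebraMap_coeff_charpoly` + `finite_setOf_algebraMap_mem_of_isCompact`, and `𝒪 ↦ p_𝒪` is injective).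
[cite: Rogawski1990, §3.3 p. 21; §5.4 (5.4.3) pp. 72–73; §14.5 pp. 237–239] [cite: Kottwitz1986, §7.3] -/
theorem finite_setOf_stableClass_meets_of_anisotropic
    (hanis : ∀ x : Fin 3 → L, Literature.AlgebraicGeometry.ShimuraVarieties.hermForm (cmConjRingHom L) H x x = 0 → x = 0)
    {C : Set (UnitaryGroup.cmDatum L 3 (Matrix.of fun i j : Fin 3 => if i.val + j.val + 1 = 3 then (1 : L) else 0)).Adelic} (hC : IsCompact C) :
    {𝒪 : StableClass (cmConjRingHom L) H | ∃ γ₀ : (UnitaryGroup.cmDatum L 3 H).Rational, stableClassOf _ _ γ₀ = 𝒪 ∧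
        ∃ c ∈ MatchingAdeleG.classes L H γ₀, ∃ g ∈ C, ConjClasses.mk g = c}.Finite := by
  classical
  -- the finite coefficient sets
  set F : ℕ → Set L := fun k => {ξ : L | algebraMap L (AdeleRing (𝓞 L) L) ξ ∈
    (fun g : (UnitaryGroup.cmDatum L 3 (Matrix.of fun i j : Fin 3 => if i.val + j.val + 1 = 3 then (1 : L) else 0)).Adelic =>
      ((g.val : GL (Fin 3) (AdeleRing (𝓞 L) L)) : Matrix (Fin 3) (Fin 3) (AdeleRing (𝓞 L) L)).charpoly.coeff k) '' C} with hF
  have hFfin : ∀ k, (F k).Finite := fun k =>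
    finite_setOf_algebraMap_mem_of_isCompact (hC.image (continuous_coeff_charpoly_adelic _ k))
  -- the coefficient vector of a stable class
  let cv : StableClass (cmConjRingHom L) H → (Fin 4 → L) := fun 𝒪 i => (StableClass.charpoly 𝒪).coeff i
  refine Set.Finite.of_finite_image (f := cv) ((Set.Finite.pi' fun i : Fin 4 => hFfin i).subset ?_) ?_
  · -- the image lies in the finite box `∏_{i<4} F i`
    rintro _ ⟨𝒪, ⟨γ₀, rfl, c, hc, g, hgC, hgc⟩, rfl⟩ i
    obtain ⟨q, hq⟩ := (MatchingAdeleG.mem_classes_iff).1 hc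
    have hconj : IsConj q.adele g := ConjClasses.mk_eq_mk_iff_isConj.1 (hq.trans hgc.symm)
    refine ⟨g, hgC, ?_⟩
    show _ = algebraMap L (AdeleRing (𝓞 L) L) ((StableClass.charpoly (stableClassOf (cmConjRingHom L) H γ₀)).coeff i)
    rw [StableClass.charpoly_stableClassOf, (q.conj g hconj).algebraMap_coeff_charpoly i, MatchingAdeleG.adele_conj]
  · -- `cv` is injective on ALL classes (anisotropy)
    rintro 𝒪 - 𝒪' - h
    refine injective_stableClassCharpoly_of_anisotropic hanis ?_
    have hdeg : ∀ (M : Matrix (Fin 3) (Fin 3) L) (n : ℕ), ¬ n < 4 → M.charpoly.coeff n = 0 := fun M n hn =>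
      Polynomial.coeff_eq_zero_of_natDegree_lt (by rw [Matrix.charpoly_natDegree_eq_dim, Fintype.card_fin]; omega)
    obtain ⟨γ, rfl⟩ := stableClassOf_surjective 𝒪
    obtain ⟨γ', rfl⟩ := stableClassOf_surjective 𝒪'
    ext n
    by_cases hn : n < 4
    · have := congrFun h ⟨n, hn⟩
      simpa only [cv, StableClass.charpoly_stableClassOf] using this
    · rw [StableClass.charpoly_stableClassOf, StableClass.charpoly_stableClassOf, hdeg _ n hn, hdeg _ n hn]

end Finite

/-! ## §3 The stable orbital integral of a compactly supported `f` vanishes at all but finitely many stable classes -/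

section Support

variable {L : Type} [Field L] [NumberField L] [IsCMField L] {H : Matrix (Fin 3) (Fin 3) L}
  [∀ g : (UnitaryGroup.cmDatum L 3 (Matrix.of fun i j : Fin 3 => if i.val + j.val + 1 = 3 then (1 : L) else 0)).Adelic,
    MeasurableSpace ((UnitaryGroup.cmDatum L 3 (Matrix.of fun i j : Fin 3 => if i.val + j.val + 1 = 3 then (1 : L) else 0)).Adelic ⧸
      Subgroup.centralizer ({g} : Set (UnitaryGroup.cmDatum L 3 (Matrix.of fun i j : Fin 3 => if i.val + j.val + 1 = 3 then (1 : L) else 0)).Adelic))]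

/-- **For ANISOTROPIC `H`, every family `m` of orbital measures on the adelic classes and every `f` with compact support, `Φ^{st,𝐀}_G(γ₀, m, f) ≠ 0` for only
finitely many stable classes `𝒪_st(γ₀)` — regular OR singular** (pin (xii-f) over all classes): ★ SF-st §4's support argument over §2.
[cite: Rogawski1990, §4.3 p. 44; §5.4 (5.4.3) pp. 72–73; §14.5 pp. 238–239] -/
theorem finite_setOf_stableClass_adelicStableOrbitalIntegralG_ne_zero_of_anisotropic
    (hanis : ∀ x : Fin 3 → L, Literature.AlgebraicGeometry.ShimuraVarieties.hermForm (cmConjRingHom L) H x x = 0 → x = 0)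
    (m : OrbitalMeasureFamily (UnitaryGroup.cmDatum L 3 (Matrix.of fun i j : Fin 3 => if i.val + j.val + 1 = 3 then (1 : L) else 0)).Adelic)
    {f : (UnitaryGroup.cmDatum L 3 (Matrix.of fun i j : Fin 3 => if i.val + j.val + 1 = 3 then (1 : L) else 0)).Adelic → ℂ}
    (hf : HasCompactSupport f) :
    {𝒪 : StableClass (cmConjRingHom L) H | ∃ γ₀ : (UnitaryGroup.cmDatum L 3 H).Rational, stableClassOf _ _ γ₀ = 𝒪 ∧
      adelicStableOrbitalIntegralG L H γ₀ m f ≠ 0}.Finite := by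
  refine (finite_setOf_stableClass_meets_of_anisotropic (H := H) hanis hf.isCompact).subset ?_
  rintro 𝒪 ⟨γ₀, rfl, hne⟩
  refine ⟨γ₀, rfl, ?_⟩
  rw [adelicStableOrbitalIntegralG_def] at hne
  obtain ⟨c, hc, hcne⟩ := exists_ne_zero_of_finsum_mem_ne_zero hne
  by_contra hno
  exact hcne (classOrbitalIntegral_eq_zero_of_forall_mk_ne m f fun g hg hgc => hno ⟨c, hc, g, hg, hgc⟩)

/-- The `Function.support` form pin (xii-f) states: for ANISOTROPIC `H` the support of `𝒪 ↦ Φ^{st,𝐀}_G(out 𝒪; m, f)` (any choice of representatives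
`rep 𝒪` with `𝒪_st(rep 𝒪) = 𝒪`) is finite. [cite: Rogawski1990, §14.5 pp. 238–239] -/
theorem finite_support_adelicStableOrbitalIntegralG_comp_of_anisotropic
    (hanis : ∀ x : Fin 3 → L, Literature.AlgebraicGeometry.ShimuraVarieties.hermForm (cmConjRingHom L) H x x = 0 → x = 0)
    (m : OrbitalMeasureFamily (UnitaryGroup.cmDatum L 3 (Matrix.of fun i j : Fin 3 => if i.val + j.val + 1 = 3 then (1 : L) else 0)).Adelic)
    {f : (UnitaryGroup.cmDatum L 3 (Matrix.of fun i j : Fin 3 => if i.val + j.val + 1 = 3 then (1 : L) else 0)).Adelic → ℂ}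
    (hf : HasCompactSupport f) (rep : StableClass (cmConjRingHom L) H → (UnitaryGroup.cmDatum L 3 H).Rational)
    (hrep : ∀ 𝒪, stableClassOf (cmConjRingHom L) H (rep 𝒪) = 𝒪) :
    (Function.support fun 𝒪 : StableClass (cmConjRingHom L) H => adelicStableOrbitalIntegralG L H (rep 𝒪) m f).Finite := by
  refine (finite_setOf_stableClass_adelicStableOrbitalIntegralG_ne_zero_of_anisotropic (H := H) hanis m hf).subset ?_
  intro 𝒪 h𝒪
  exact ⟨rep 𝒪, hrep 𝒪, Function.mem_support.1 h𝒪⟩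

end Support

end Literature.NumberTheory.Rogawski1990

end
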